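import Mathlib
import Literature.MathematicalPhysics.QuantumFieldTheory.Balaban1983to89.B16Ineq147FirstFrom190
import Literature.MathematicalPhysics.QuantumFieldTheory.Balaban1983to89.B6Geometry
import Literature.MathematicalPhysics.QuantumFieldTheory.Balaban1983to89.B6Ineq261LevelGap
import Literature.MathematicalPhysics.QuantumFieldTheory.Balaban1983to89.B15TouchingCubeContours
import Literature.MathematicalPhysics.QuantumFieldTheory.Balaban1983to89.B16Sect1BoxCounts

/-!
# `Balaban1983to89.B16Ineq147Count261` — [Balaban1989LargeFieldII] (1.47) p. 368: print's IMPLICIT LATTICE-SUM COUNT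
«Σ_{j=1}^{h} Σ_{x∈Γ″_j} exp(−½δd(x, Ω″^{~2}_{h+1})) … ≦ O(1)|Γ″_h ∩ Ω″^{~2}_{h+1}|» (hypothesis `hS` / `hcount` of
`B16Ineq147Chain`, `B16Ineq147FirstFrom190`) DERIVED FROM THE ROW SUM (2.61) OF LEMMA 2.1 [Balaban1984PropagatorsII], and the
whole display (1.47) with that count discharged

T. Bałaban, *Large field renormalization. II. Localization, exponentiation, and bounds for the 𝐑 operation*, Commun. Math.
Phys. **122** (1989) 355–392 [Balaban1989LargeFieldII] (cell paper B16; PDF held `paper:balaban1989-cmp122-large-field-ii`,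
journal page = PDF page + 354; p. 368 = PDF 14, text layer `p0014.txt` read by this seat: *«The argument of the function
H″_{h+2} has a support in the domain Ω″^{~2}_{h+1} ∩ Z″_{h+2}. This is very important, because the exponential decay of this
function suppresses strongly large values of 1/(g″_k(·))². … For example, consider the most dangerous term, the term linear in
H″_{h+2}. It can be bounded in the following way: …(1.47)»*; the display itself is garbled in the text layer and is taken LETTER
FOR LETTER from r13 gen 12's typing `B16Ineq147Chain` §1, which re-read the render `…-p014-x2.png` as an image), with
T. Bałaban, *Propagators and renormalization transformations for lattice gauge theories. II*, Commun. Math. Phys. **96** (1984)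
223–250 [Balaban1984PropagatorsII] (cell paper B6; PDF held `paper:balaban1984-cmp96-propagators-rt-ii`, journal page = PDF
page + 222; p. 234 = PDF 12, text layer `p0012.txt` read by this seat: *«Lemma 2.1. For the numbers α, 0 < α < 1, c₁(α) =
12c₀(½α), and RM satisfying (2.59) … sup_{y∈𝔅} Σ_{y′∈𝔅} e^{−αδ₀d(y,y′)} ≤ c₁(α), (2.61)»*).

statement-level skeleton of published theorems with citation tags; proofs where landed; nothing here is a claim about the Yang–Mills mass gap

CITATION HEADER / WHAT IS REPRODUCED.  Mega-formalization `lit-balaban`, HOME `run/shared/lean/pub/lit-balaban/`; Phase-2 proof seat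
p29 gen 10 (unit `lit-balaban-p29`, free-target protocol G.5-34(d)).  SKELETON row **B16.Eq1.47** (owner r13; head `proved p305569`;
r13's `SURVEY-B16-remaining.md` §B: *«optional successor work: discharge print's implicit double-sum count hS»*).  THE PRINTED STEP
(p. 368 [14], r13's verbatim transcription in `B16Ineq147Chain`): line 2 ⇒ line 3 of (1.47),
*«≦ O(1)(1/g_k²)(α_{0,k} + α_{1,k})ε_kL^{−N}N^{1+β₀}·B₃³B₅M⁶ Σ_{j=1}^{h} Σ_{x∈Γ″_j} exp(−½δd(x, Ω″^{~2}_{h+1}))exp(−½δM(h − j))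
(1 + h − j)^{1+β₀} ≦ O(1)A₀C₁B₃³B₅M⁶p₀(g_k)q₁(g_k)R_k²L^{−N}|Γ″_h ∩ Ω″^{~2}_{h+1}|»* — the lattice-sum count
*«Σ_j Σ_{x∈Γ″_j} exp(−½δd(x, Ω″^{~2}_{h+1}))·(…) ≦ O(1)|Γ″_h ∩ Ω″^{~2}_{h+1}|»* is IMPLICIT in print; r13's chain carries it as the ONE
named hypothesis `hS` (`B16Ineq147Chain.rhs147b_le_rhs147c` / `ineq147_of_first`), split into the per-scale count `hcount`
(*«geometric, not derived»*) and the scale sum `Σ_j exp(−½δM(h − j))(1 + h − j)^{1+β₀} ≦ 2` (`scaleSum_le_two`, PROVED for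
`δM ≧ 6`); my gen-9 `B16Ineq147FirstFrom190.ineq147_of_ineq190` carries `hS` verbatim.

THE MECHANISM (what print's «O(1)» is).  The distance of (1.47) is the MULTISCALE distance `d(y, y′)` of [Balaban1984PropagatorsII]
(2.46) on the generating set `𝔅 = ⋃_j Λ_j` (the tree's `B6.Geometry.dist`; it is the distance of the decay (190) [15] from which
line 1 of (1.47) is derived in `B16Ineq147FirstFrom190`, and the sets `Γ″_j` are the scale-`j` members of the generating set
`𝔅″_k = {Γ″_j}` of (1.13) [IV]), and `d(x, Ω″^{~2}_{h+1})` is the distance from (the block of) the point `x` to the blocks `S`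
carrying the argument of `𝐇″_{h+2}` (*«has a support in the domain Ω″^{~2}_{h+1} ∩ Z″_{h+2}»*).  For such a distance
`exp(−½δ·d(x, S)) ≦ Σ_{y′∈S} exp(−½δ·d(y(x), y′))` (the minimum is one term of the sum), so after exchanging the sums the
row sum (2.61) of Lemma 2.1 — which is a sum over ALL of `𝔅`, i.e. over all scales at once — bounds EVERY scale's lattice sum:
`Σ_{x∈Γ″_j} exp(−½δ d(x, S)) ≦ m·c₁·|S|`, `m` = the number of points `x` per block (1 when the `x` are the blocks themselves),
`c₁` = the constant of (2.61) at the rate `½δ`, with NO dependence on `j` — exactly the per-scale count `hcount` of r13's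
`sum147b_le_of_count`, hence `hS` with `O(1) = 2m·c₁` and the cardinality `|S|` of the support in place of print's
`|Γ″_h ∩ Ω″^{~2}_{h+1}|` (print names the scale-`h` part `Γ″_h ∩ Ω″^{~2}_{h+1}` of that support; the next printed step bounds the
cardinality by `O(1)M⁴R_k⁵` either way — hypothesis `hΓ` of r13's chain, kept in its shape, on `|S|`).  The symmetry
`d(y, y′) = d(y′, y)` turns the column sums into the row sums of (2.61); it holds for every geometry realised by a contour system
(`B6Geometry.dist_comm_of_realizes`) and is taken here as the hypothesis `hsymm`.

WHAT THIS FILE PROVES (kernel-checked, zero `sorry`, theorems only — no definition, no named fact; axioms standard).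
§1 `colSum_le_of_rowSum`, `sum_exp_fibre_le`, **`sum_exp_le_card_of_rowSum`** — for `RowSum g σ c` ((2.61) at rate `σ ≧ 0`),
   `d` symmetric, a finite family `Γ` of points with block map `yOf` of multiplicity `≦ m` per block, a finite set `S` of blocks
   and any `dist` with `dist x ≧ d(yOf x, y′)` for SOME `y′ ∈ S`: `Σ_{x∈Γ} exp(−σ·dist x) ≦ (m·c)·|S|`.
§2 **`hcount_of_rowSum`** — r13's per-scale count `hcount` (`∀ j ∈ [1, h], Σ_{x∈Γ″_j} exp(−½δ·dist x) ≦ CΓ·cardΓ`) with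
   `CΓ = m·c`, `cardΓ = |S|`, from (2.61) at rate `½δ`; **`sum147b_le_of_rowSum`** — print's implicit count `hS` itself:
   `sum147b δ M β₀ h Γ dist ≦ 2(m·c)·|S|` (via r13's `sum147b_le_of_count`, `δM ≧ 6`, `β₀ ≦ 1`).
§3 **`ineq147_of_ineq190_rowSum`** — THE WHOLE DISPLAY (1.47), `B16Sect1Statements.Ineq147 …` BY NAME, as my gen-9
   `B16Ineq147FirstFrom190.ineq147_of_ineq190` but with `hS` DISCHARGED by §2 and the geometry letter `hgeom` DISCHARGED by the
   dictionary «`dist x` = the distance from the block of `x` to the support `S` of the argument» (`hSupp`, `hdistS`, `hdistS'`) and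
   the rate bookkeeping `δ ≦ τ`; what is carried: (190), the two row sums ((2.61) at the knitting rate `σ` and at `½δ`), `hmv`, the
   source size, the J-side letters, `hne`, r13's chain inputs ((2.8)[III] third member, `k = h + N`, `N ≦ R_k`, dictionary,
   `δM ≧ 6`), the separation `hdist` (*«d(x, Ω″^{~2}_{h+1}) ≧ M(h − j)»*, the nesting of (1.12) [IV] — NOT derived here) and the
   box count `|S| ≦ C_γM⁴R_k⁵`.
§4 **`ineq147_sectG_rowSum`** — END TO END for one lattice presentation of r08's (179)–(180) chart: (1.47) BY NAME with (190) AND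
   `hmv` discharged by r08 g10's `B11Ineq190Actual.ineq190_and_hmv_supSize_sectG` (through my gen-9 `ineq147First_sectG`) AND the
   count discharged by §2; remaining hypotheses = r08's located leaves of [15] Sect. G verbatim + the [16]-side letters + `hdist` +
   the box count.
§5 (v1.1, append-only) **`hdist_of_levelGap`**, **`ineq147_of_ineq190_levelGap`** — the SEPARATION `hdist` (*«d(x, Ω″^{~2}_{h+1}) ≧
   M(h − j)»* on `Γ″_j`, the last geometric hypothesis of §3) DERIVED, for geometries REALISED by a contour system
   (`B6Geometry.Realizes`, admissible contours exist) satisfying the walk form of (2.2) [B6] / of the nesting (1.12) [IV]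
   (`B6Geometry.LevelGap N`), from ZONE DATA: the blocks carrying the argument have scale `≥ h + 1` and the block of a point of `Γ″_j`
   has scale `≤ j` — by the level-gap bound `B6Geometry.levelGap_dist` *"N·(zone′ − zone − 1) ≤ d"*, `d(x, S) ≥ N(h − j) ≥ M(h − j)`
   for `M ≤ N`; §3 restated with `hdist`, `hsymm`, `hd` discharged (`dist_comm_of_realizes`, `dist_nonneg_of_realizes`).  READING
   (declared): the zone data are this file's rendering of *«The argument of the function 𝐇″_{h+2} has a support in the domain
   Ω″^{~2}_{h+1} ∩ Z″_{h+2}»* (scale-`(h+1)` and coarser blocks of the generating set of `𝐇″_{h+2}`) and of `Γ″_j = (Ω″_j∖Ω″_{j+1})^{(j)}`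
   ((1.13) [IV]); they are hypotheses, not constructed.
§6 (v1.2, append-only; new import `B6Ineq261LevelGap`) **`ineq147_of_ineq190_packing`** — §5 with, in addition, BOTH ROW SUMS ((2.61) at
   the knitting rate `σ` and at `½δ`) DISCHARGED by `B6Ineq261LevelGap.rowSum_K261_of_realizes` ([B6] Lemma 2.1 (2.61) proved for realised
   contour systems, p29 g10): the geometry enters only through `Realizes` (ι injective, admissible contours exist), the walk form
   `LevelGap Ngap` (`Ngap ≥ 1`), the bond scales `B6LevelGapMetric.BondScale C.bond C.zone pos ℓ` (`0 < ℓ n ≤ ℓ(n+1) ≤ L·ℓ n`, `L ≥ 1`)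
   and the per-scale packing of the lattices `Λ_j`; row-sum constants `K261 Ngap dd L A σ`, `K261 Ngap dd L A (δ/2)` under the
   (2.59)-shape conditions `e^{−σ}L^{2dd/Ngap} < 1`, `e^{−δ/2}L^{2dd/Ngap} < 1`; and **`ineq147_of_ineq190_cubeSites`** — the same on
   the ℤᵈ CUBE-SITE MODEL of `B15Ineq147LevelGap` (`CubeSite M₁ L Z`, any bond graph within the coarser scale, its `LevelGap Ngap` and
   connectedness given; `B6Ineq261LevelGap.rowSum_cubeSites`): on that model class every geometric input of (1.47) is a theorem.
§7 (v1.3, append-only; new import `B15TouchingCubeContours`) **`ineq147_of_ineq190_touchC`** — §6's cube-site form with the bond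
   graph FIXED to the graph `touchC` of TOUCHING cubes (p29 g11 `B15TouchingCubeContours`): its connectedness (`touchC_connected`, from
   the covering `Tiles` = [B6] (2.4) «T = ⋃_j B^j(Λ_j)»), its walk form of (2.2) (`levelGap_touchC_sharp`, from `Monotone Z″` + the
   one-layer separation `LayerSepZd Z″ M_Z L` of [IV] p. 179, by point chains) and its coarse-side bonds (`touchC_adj_dist`) are
   THEOREMS, so (1.47) holds BY NAME for every geometry realised by touching-cube contours with NO graph-theoretic hypothesis left:
   what is carried is the printed shape of `Z″` (`Monotone`, `LayerSepZd`, `Tiles`), `M₁ ≥ 1`, `L ≥ 1`, a level count `Ngap ≥ 1`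
   with `Ngap + 1 ≤ L·(M_Z/M₁)`, the two (2.59)-shape conditions, and the analytic/[16]-side letters of §6 verbatim;
   **`card_le_of_embedding_box`** (new import `B16Sect1BoxCounts`) — the LAST counting hypothesis `|S| ≦ C_γM⁴R_k⁵` from an
   EMBEDDING LETTER (r13 gen 14's suggestion): any finite set `S` injected into a box of `n ≦ C_b·L·M·R_{h+1}` sites per
   direction of the scale-`h` torus `T^{(j)}` of `…Setup` (`B16Sect1BoxCounts.boxSites`, [IV] condition (i) p. 177 / p. 195
   parallelepipeds) has `|S| ≦ (C_bLC₃)⁴M⁴R_k⁵` by r13's `cardΓ147_of_box` (`R_{h+1} ≦ C₃N^{β₀}R_k`, `4β₀ ≦ 1`, `1 ≦ N ≦ R_k`,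
   `d = 4`); **`ineq147_of_ineq190_touchC_box`** — (1.47) on the touching-cube contours with `hΓ` so DISCHARGED
   (`C_γ = (C_bLC₃)⁴`): no counting hypothesis left either.
HONEST SCOPE.  The reading «print's `d(x, Ω″^{~2}_{h+1})` = the (2.46)-distance from the block of `x` to the blocks carrying the
argument, and print's `|Γ″_h ∩ Ω″^{~2}_{h+1}|` = (a bound for) the number of those blocks» is DECLARED (it is the reading under
which line 1 was derived from (190) in `B16Ineq147FirstFrom190`; print's display names the scale-`h` part of the support); (2.61)
enters as the hypothesis `RowSum` in §1–§5 (row B6.Lem2.1 — for realised geometries see `B6Geometry.lemma21Printed_of_ineq261`,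
`B6Lemma21Repaired`, `B6Lemma21TowerTorus`) and is DISCHARGED in §6 with an `L`-dependent constant (`B6Ineq261LevelGap`, whose honest
scope (i) applies: print's c₁ depends on d, α only); the separation `hdist` (in §3–§4; derived from zone data in §5–§6) and the box count stay hypotheses in r13's printed shapes;
nothing about `U″_{h+2}`, `ζ₁`, `g″_k(·)` is constructed.  NOT summit progress.
-/

namespace Literature.MathematicalPhysics.QuantumFieldTheory.Balaban1983to89.B16Ineq147Count261

open Literature.MathematicalPhysics.QuantumFieldTheory.Balaban1983to89
open B11SectG B16Ineq147Chain B16Ineq147FirstFrom190 Finset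

noncomputable section

variable {g : B6.Geometry} [DecidableEq g.Site] {α : Type*}

/-! ## §1. The lattice-sum count from the row sum (2.61) -/

omit [DecidableEq g.Site] in
/-- Column sums are row sums for a symmetric distance: `Σ_{y} e^{−σd(y,y′)} ≦ c` from (2.61) `sup_{y} Σ_{y′} e^{−σd(y,y′)} ≦ c`
and `d(y, y′) = d(y′, y)`. [cite: Balaban1984PropagatorsII, Lemma 2.1 (2.61) p.234] -/
theorem colSum_le_of_rowSum {σ c : ℝ} (hrow : RowSum g σ c) (hsymm : ∀ a b : g.Site, g.dist a b = g.dist b a)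
    (y' : g.Site) : ∑ y : g.Site, Real.exp (-(σ * g.dist y y')) ≤ c :=
  calc ∑ y : g.Site, Real.exp (-(σ * g.dist y y')) = ∑ y : g.Site, Real.exp (-(σ * g.dist y' y)) :=
        Finset.sum_congr rfl fun y _ => by rw [hsymm y y']
    _ ≤ c := hrow y'

/-- A finite family of points `Γ` labelled by blocks (`yOf : α → 𝔅`) with at most `m` points per block: for every block `y′`,
`Σ_{x∈Γ} e^{−σd(yOf x, y′)} ≦ m·c` by (2.61) and symmetry. [cite: Balaban1984PropagatorsII, Lemma 2.1 (2.61) p.234] -/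
theorem sum_exp_fibre_le {σ c : ℝ} (hrow : RowSum g σ c) (hsymm : ∀ a b : g.Site, g.dist a b = g.dist b a)
    (Γ : Finset α) (yOf : α → g.Site) {m : ℕ} (hm : ∀ y : g.Site, #{x ∈ Γ | yOf x = y} ≤ m) (y' : g.Site) :
    ∑ x ∈ Γ, Real.exp (-(σ * g.dist (yOf x) y')) ≤ m * c := by
  rw [← Finset.sum_fiberwise' Γ yOf (fun y => Real.exp (-(σ * g.dist y y')))]
  calc ∑ y : g.Site, ∑ x ∈ Γ with yOf x = y, Real.exp (-(σ * g.dist y y'))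
      = ∑ y : g.Site, (#{x ∈ Γ | yOf x = y} : ℝ) * Real.exp (-(σ * g.dist y y')) :=
        Finset.sum_congr rfl fun y _ => by rw [Finset.sum_const, nsmul_eq_mul]
    _ ≤ ∑ y : g.Site, (m : ℝ) * Real.exp (-(σ * g.dist y y')) :=
        Finset.sum_le_sum fun y _ =>
          mul_le_mul_of_nonneg_right (by exact_mod_cast hm y) (Real.exp_pos _).le
    _ = m * ∑ y : g.Site, Real.exp (-(σ * g.dist y y')) := by rw [Finset.mul_sum]
    _ ≤ m * c := mul_le_mul_of_nonneg_left (colSum_le_of_rowSum hrow hsymm y') (Nat.cast_nonneg m)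

/-- **The lattice-sum count from (2.61).**  For `RowSum g σ c` at a rate `σ ≧ 0`, `d` symmetric, a finite family of points `Γ`
with block map `yOf` of multiplicity `≦ m` per block, a finite set `S` of blocks, and any `dist` with `dist x ≧ d(yOf x, y′)` for
some `y′ ∈ S` at every `x ∈ Γ` (e.g. `dist x` = the distance from the block of `x` to `S`):
`Σ_{x∈Γ} exp(−σ·dist x) ≦ (m·c)·|S|` — `exp(−σ·dist x)` is one term of `Σ_{y′∈S} exp(−σd(yOf x, y′))`, the sums are exchanged,
and each column sum is `≦ m·c`.  This is the «O(1)·(cardinality)» of the step line 2 ⇒ line 3 of (1.47).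
[cite: Balaban1989LargeFieldII, (1.47) p.368; Balaban1984PropagatorsII, Lemma 2.1 (2.61) p.234] -/
theorem sum_exp_le_card_of_rowSum {σ c : ℝ} (hrow : RowSum g σ c) (hsymm : ∀ a b : g.Site, g.dist a b = g.dist b a)
    (hσ : 0 ≤ σ) (Γ : Finset α) (yOf : α → g.Site) {m : ℕ} (hm : ∀ y : g.Site, #{x ∈ Γ | yOf x = y} ≤ m)
    (S : Finset g.Site) {dist : α → ℝ} (hdist : ∀ x ∈ Γ, ∃ y' ∈ S, g.dist (yOf x) y' ≤ dist x) :
    ∑ x ∈ Γ, Real.exp (-(σ * dist x)) ≤ (m * c) * #S := by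
  calc ∑ x ∈ Γ, Real.exp (-(σ * dist x))
      ≤ ∑ x ∈ Γ, ∑ y' ∈ S, Real.exp (-(σ * g.dist (yOf x) y')) := by
        refine Finset.sum_le_sum fun x hx => ?_
        obtain ⟨y', hy', hle⟩ := hdist x hx
        have hmono : Real.exp (-(σ * dist x)) ≤ Real.exp (-(σ * g.dist (yOf x) y')) :=
          Real.exp_le_exp.mpr (by nlinarith [mul_le_mul_of_nonneg_left hle hσ])
        exact hmono.trans
          (Finset.single_le_sum (f := fun y'' => Real.exp (-(σ * g.dist (yOf x) y'')))
            (fun _ _ => (Real.exp_pos _).le) hy')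
    _ = ∑ y' ∈ S, ∑ x ∈ Γ, Real.exp (-(σ * g.dist (yOf x) y')) := Finset.sum_comm
    _ ≤ ∑ y' ∈ S, (m : ℝ) * c := Finset.sum_le_sum fun y' _ => sum_exp_fibre_le hrow hsymm Γ yOf hm y'
    _ = (m * c) * #S := by rw [Finset.sum_const, nsmul_eq_mul]; ring

/-! ## §2. The per-scale count `hcount` and print's implicit count `hS` of (1.47) from (2.61) -/

/-- **r13's per-scale count `hcount` FROM (2.61)** (p. 368 [14]): for the scales `j = 1, …, h`, finite families `Γ″_j` of points
with block maps `yOf j` of multiplicity `≦ m`, a finite set `S` of blocks and `dist x ≧ d(yOf j x, y′)` for some `y′ ∈ S` on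
`Γ″_j`: `Σ_{x∈Γ″_j} exp(−½δ·dist x) ≦ (m·c)·|S|` for every `j`, from `RowSum g (δ/2) c` and symmetry — the hypothesis `hcount` of
`B16Ineq147Chain.sum147b_le_of_count` / `ineq147_of_first_count` with `CΓ = m·c`, `cardΓ = |S|`, uniformly in `j` (the row sum
(2.61) runs over the whole multiscale set `𝔅`). [cite: Balaban1989LargeFieldII, (1.47) p.368; Balaban1984PropagatorsII, Lemma 2.1 (2.61) p.234] -/
theorem hcount_of_rowSum {δ c : ℝ} (hrow : RowSum g (δ / 2) c) (hsymm : ∀ a b : g.Site, g.dist a b = g.dist b a)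
    (hδ : 0 ≤ δ) {h : ℕ} (Γ : ℕ → Finset α) (yOf : ℕ → α → g.Site) {m : ℕ}
    (hm : ∀ j ∈ Icc 1 h, ∀ y : g.Site, #{x ∈ Γ j | yOf j x = y} ≤ m)
    (S : Finset g.Site) {dist : α → ℝ} (hdist : ∀ j ∈ Icc 1 h, ∀ x ∈ Γ j, ∃ y' ∈ S, g.dist (yOf j x) y' ≤ dist x) :
    ∀ j ∈ Icc 1 h, ∑ x ∈ Γ j, Real.exp (-(δ / 2 * dist x)) ≤ (m * c) * #S := fun j hj =>
  sum_exp_le_card_of_rowSum hrow hsymm (by linarith) (Γ j) (yOf j) (hm j hj) S (hdist j hj)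

/-- **Print's implicit count `hS` of (1.47) FROM (2.61)** (p. 368 [14], the step line 2 ⇒ line 3): the double sum of line 2
`Σ_{j=1}^{h} Σ_{x∈Γ″_j} exp(−½δd(x, ·))exp(−½δM(h − j))(1 + h − j)^{1+β₀}` (`B16Ineq147Chain.sum147b δ M β₀ h Γ dist`) is at most
`2(m·c)·|S|`, from the row sum (2.61) at rate `½δ`, symmetry, the dictionary `dist x ≧ d(yOf j x, y′)` (some `y′ ∈ S`), the
multiplicity `m`, and the located `δM ≧ 6`, `β₀ ≦ 1` of r13's `scaleSum_le_two` — `hS` with `O(1) = 2m·c` and the support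
cardinality `|S|`. [cite: Balaban1989LargeFieldII, (1.47) p.368; Balaban1984PropagatorsII, Lemma 2.1 (2.61) p.234] -/
theorem sum147b_le_of_rowSum {δ c M β₀ : ℝ} (hrow : RowSum g (δ / 2) c) (hsymm : ∀ a b : g.Site, g.dist a b = g.dist b a)
    (hδ : 0 ≤ δ) (hδM : 6 ≤ δ * M) (hβ₁ : β₀ ≤ 1) {h : ℕ} (Γ : ℕ → Finset α) (yOf : ℕ → α → g.Site) {m : ℕ}
    (hm : ∀ j ∈ Icc 1 h, ∀ y : g.Site, #{x ∈ Γ j | yOf j x = y} ≤ m)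
    (S : Finset g.Site) {dist : α → ℝ} (hdist : ∀ j ∈ Icc 1 h, ∀ x ∈ Γ j, ∃ y' ∈ S, g.dist (yOf j x) y' ≤ dist x)
    (hc : 0 ≤ c) :
    sum147b δ M β₀ h Γ dist ≤ 2 * (m * c) * #S :=
  sum147b_le_of_count hδM hβ₁ (by positivity) (Nat.cast_nonneg _) (hcount_of_rowSum hrow hsymm hδ Γ yOf hm S hdist)

/-! ## §3. The whole display (1.47) from (190), the count and the geometry letter discharged -/

section Abstract

variable {FB FA : Type} [AddCommGroup FB] [Module ℝ FB] [AddCommGroup FA] [Module ℝ FA]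

/-- **(1.47) p. 368 FROM [15] (190), PRINT'S IMPLICIT COUNT DISCHARGED BY (2.61).**  `B16Sect1Statements.Ineq147 T
(C(1+C′)(1+β₀)²·(2m·c₂)·C_γ) A₀ C₁ B₃ B₅ M p₀g q₁g Rk Linv N` BY NAME — my gen-9 `B16Ineq147FirstFrom190.ineq147First_of_ineq190`
(line 1 from (190) at every base point, (2.61) at the knitting rate `σ`, `hmv`, the source size, the J-side letters, `hne`) fed to
r13's `B16Ineq147Chain.ineq147_of_first_count`, with: the DICTIONARY of the distance — `S` a finite set of blocks containing the
support of the argument `B` (`hSupp`, *«has a support in the domain Ω″^{~2}_{h+1} ∩ Z″_{h+2}»*), `dist x ≦ d(yOf j x, y′)` for all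
`y′ ∈ S` (`hdistS`) and `= d(yOf j x, y′)` for some `y′ ∈ S` (`hdistS'`), i.e. `dist x = d(x, S)` — which gives the geometry letter
`hgeom` of gen 9 for `δ ≦ τ` AND, with (2.61) at rate `½δ` (`hrow₂`), symmetry of `d` and the multiplicity `m` of the block maps,
the per-scale count (§2); r13's remaining inputs verbatim (`0 < g_k ≦ 1`, `0 ≦ β₀ ≦ 1`, `1 ≦ N`, `k = h + N`, `δM ≧ 6`, the
separation `hdist` *«d(x, Ω″^{~2}_{h+1}) ≧ M(h − j)»* on `Γ″_j`, the third member of (2.8) [III], the dictionary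
`alpha = C₁g_kq₁(g_k)`, `ε_k = g_kA₀p₀(g_k)`, `N ≦ R_k`) and the box count `|S| ≦ C_γM⁴R_k⁵`.
[cite: Balaban1989LargeFieldII, (1.47) p.368; Balaban1985Variational, Prop. 9 (190) pp.308–309; Balaban1984PropagatorsII, Lemma 2.1 (2.61) p.234] -/
theorem ineq147_of_ineq190_rowSum {T : Type*} {bB : BlockNorm g FB} {bout : BlockNorm g FA} {dH : T → FB →ₗ[ℝ] FA}
    {Cc δ₀ σ τ c c₂ B₃ δ C Linv B₅ M alpha gk C' εk β₀ C₁ q₁g A₀ p₀g Rk Cγ : ℝ} {N k h : ℕ} {ε : ℕ → ℝ}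
    {Γ : ℕ → Finset α} {dist : α → ℝ}
    (h190 : ∀ t, Ineq190 bB bout (dH t) Cc δ₀) (hCc : 0 ≤ Cc) (hd : ∀ a b : g.Site, 0 ≤ g.dist a b)
    (hsymm : ∀ a b : g.Site, g.dist a b = g.dist b a) (hrow : RowSum g σ c) (hrow₂ : RowSum g (δ / 2) c₂)
    (hτ : 0 ≤ τ) (hστ : σ + τ ≤ δ₀ / 8) (hδτ : δ ≤ τ) (B : FB) {HB : FA}
    (hmv : ∀ (y : g.Site) (s : ℝ), (∀ t, bout.loc y (dH t B) ≤ s) → bout.loc y HB ≤ s)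
    (hm : ∀ y', bB.loc y' B < C * Linv ^ N * B₃ ^ 2 * B₅ * M ^ 6 * alpha)
    {S : Finset g.Site} (hSupp : ∀ y', bB.loc y' B ≠ 0 → y' ∈ S)
    (hCB : Cc * bB.κ * c ≤ B₃) (hB₃ : 0 < B₃)
    {yOf : ℕ → α → g.Site} {nf : α → ℝ} {nJ s : ℕ → α → ℝ} {m : ℕ}
    (hmult : ∀ j ∈ Icc 1 h, ∀ y : g.Site, #{x ∈ Γ j | yOf j x = y} ≤ m)
    (hdistS : ∀ j ∈ Icc 1 h, ∀ x ∈ Γ j, ∀ y' ∈ S, dist x ≤ g.dist (yOf j x) y')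
    (hdistS' : ∀ j ∈ Icc 1 h, ∀ x ∈ Γ j, ∃ y' ∈ S, g.dist (yOf j x) y' ≤ dist x)
    (hdom : ∀ j ∈ Icc 1 h, ∀ x ∈ Γ j, nf x ≤ bout.loc (yOf j x) HB)
    (hJ : ∀ j ∈ Icc 1 h, ∀ x ∈ Γ j, nJ j x ≤ ((gk ^ 2)⁻¹ + C' * ((k : ℝ) - j)) * ε j)
    (hJnn : ∀ j ∈ Icc 1 h, ∀ x ∈ Γ j, 0 ≤ nJ j x)
    (hJpos : ∀ j ∈ Icc 1 h, (Γ j).Nonempty → 0 < ((gk ^ 2)⁻¹ + C' * ((k : ℝ) - j)) * ε j)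
    (hpair : ∀ j ∈ Icc 1 h, ∀ x ∈ Γ j, |s j x| ≤ nf x * nJ j x)
    (hne : ∃ j ∈ Icc 1 h, (Γ j).Nonempty) {Tval : ℝ} (hT : Tval = ∑ j ∈ Icc 1 h, ∑ x ∈ Γ j, s j x)
    -- r13's chain inputs (line 1 ⇒ 2 ⇒ 3 ⇒ (1.47)), verbatim except `hS` (now derived)
    (hC : 0 ≤ C) (hLinv : 0 ≤ Linv) (hB₅ : 0 ≤ B₅) (hα : 0 ≤ alpha)
    (hgk : 0 < gk) (hgk1 : gk ≤ 1) (hC' : 0 ≤ C') (hεk : 0 ≤ εk) (hδ : 0 ≤ δ) (hβ₀ : 0 ≤ β₀)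
    (hβ₁ : β₀ ≤ 1) (hN : 1 ≤ N) (hk : k = h + N) (hδM : 6 ≤ δ * M)
    (hdist : ∀ j ∈ Icc 1 h, ∀ x ∈ Γ j, M * ((h : ℝ) - j) ≤ dist x)
    (hε : ∀ j ∈ Icc 1 h, ε j ≤ (1 + β₀) ^ 2 * ((k : ℝ) - j) ^ β₀ * εk)
    (hαeq : alpha = C₁ * gk * q₁g) (hεeq : εk = gk * A₀ * p₀g) (hNW : B16Sect1Kernels.NWindowUpper N Rk)
    (hΓ : (#S : ℝ) ≤ Cγ * M ^ 4 * Rk ^ 5) :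
    B16Sect1Statements.Ineq147 Tval ((C * (1 + C') * (1 + β₀) ^ 2 * (2 * (m * c₂))) * Cγ) A₀ C₁ B₃ B₅ M p₀g q₁g
      Rk Linv N := by
  obtain ⟨j₀, hj₀, x₀, hx₀⟩ := hne
  -- the support `S` is non-empty (the distance of the point `x₀ ∈ Γ″_{j₀}` is attained in `S`)
  obtain ⟨y₁, hy₁, _⟩ := hdistS' j₀ hj₀ x₀ hx₀
  have hSne : S.Nonempty := ⟨y₁, hy₁⟩
  -- `Dd y` := the distance from the block `y` to `S`
  set Dd : g.Site → ℝ := fun y => S.inf' hSne (fun y' => g.dist y y') with hDd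
  have hD : ∀ y y', bB.loc y' B ≠ 0 → Dd y ≤ g.dist y y' := fun y y' hy' =>
    Finset.inf'_le (fun y'' => g.dist y y'') (hSupp y' hy')
  have hgeom : ∀ j ∈ Icc 1 h, ∀ x ∈ Γ j, δ * dist x ≤ τ * Dd (yOf j x) := by
    intro j hj x hx
    have hle : dist x ≤ Dd (yOf j x) := (Finset.le_inf'_iff hSne _).mpr (hdistS j hj x hx)
    obtain ⟨y', _, hy'⟩ := hdistS' j hj x hx
    have h0 : 0 ≤ dist x := (hd _ _).trans hy'
    calc δ * dist x ≤ τ * dist x := mul_le_mul_of_nonneg_right hδτ h0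
      _ ≤ τ * Dd (yOf j x) := mul_le_mul_of_nonneg_left hle hτ
  have hfirst := ineq147First_of_ineq190 h190 hCc hd hrow hτ hστ B hmv hm hD hCB hB₃ hdom hgeom hJ hJnn hJpos hpair
    ⟨j₀, hj₀, x₀, hx₀⟩ hT
  have hc₂ : 0 ≤ c₂ := hrow₂.nonneg (yOf j₀ x₀)
  exact ineq147_of_first_count hfirst hB₃.le hC hLinv hB₅ hα hgk hgk1 hC' hεk hδ hβ₀ hβ₁ hN hk hδM hdist hε hαeq hεeq
    hNW (by positivity) (Nat.cast_nonneg _) (hcount_of_rowSum hrow₂ hsymm hδ Γ yOf hmult S hdistS') hΓ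

end Abstract

/-! ## §4. (1.47) END TO END from the located leaves of [15] Sect. G, the count discharged -/

section SectG

open B11Eq174Chart B11Eq183Differentiation B11Presentation190 B11Ineq190Actual B6RandomWalk

variable {𝒳 𝒴 𝒵 : Type} [NormedAddCommGroup 𝒳] [NormedSpace ℂ 𝒳] [NormedAddCommGroup 𝒴] [NormedSpace ℂ 𝒴]
  [NormedAddCommGroup 𝒵] [NormedSpace ℂ 𝒵] [CompleteSpace 𝒳] [CompleteSpace 𝒴] [CompleteSpace 𝒵]
  {𝒢 : 𝒵 →L[ℂ] 𝒴} {W : 𝒴 → 𝒵} {D2 : 𝒴 →L[ℂ] 𝒵} {H₀ : 𝒳 →L[ℂ] 𝒴} {B₀ θ C₄ a₃ j a ε₄ : ℝ}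
  {X E : Type} [NormedAddCommGroup E] [NormedSpace ℝ E] {box : g.Site → Finset X}

/-- **(1.47) p. 368 END TO END FROM THE LOCATED LEAVES OF [15] SECT. G, PRINT'S IMPLICIT COUNT DISCHARGED BY (2.61).**  For r08's
(179)–(180) chart `𝓗(B) = B11Eq183Differentiation.chartH179 𝒢 W D2 H₀ (· − H(D ·)) ε₄ B` and ONE lattice presentation
`ev : X → (𝒴 →L[ℝ] E)` of the values `(D𝐇″_{h+2})(x)` (compatibility letter `‖ev x v‖ ≤ bN.loc y v` on the box of `y`; the points
`x ∈ Γ″_j` lie in the boxes of their blocks, `x ∈ box (yOf j x)`), the WHOLE DISPLAY `B16Sect1Statements.Ineq147 (Σ_{j=1}^{h}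
Σ_{x∈Γ″_j} s j x) (C(1+C′)(1+β₀)²(2m·c₂)C_γ) A₀ C₁ B₃ B₅ M p₀g q₁g Rk Linv N` with the pairing letter `|s j x| ≤ ‖ev x (𝓗(B))‖ · nJ j x`
holds — (190) at every base point AND the mean-value domination DISCHARGED by r08 g10's `B11Ineq190Actual.ineq190_and_hmv_supSize_sectG`
(through `B16Ineq147FirstFrom190.ineq147First_sectG`), the COUNT `hS` DISCHARGED by (2.61) at rate `½δ` (§2), the geometry letter
by the dictionary `dist x = d(x, S)`.  Hypotheses: r08's located leaves of Sect. G verbatim ((189) `h189` on the domain, the kernel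
letters `hG`/`hD2H0`/`hH0`/`hH`, (73) `hDfr`, (2.54) `htri`, `q < 1`, `hN`/`hBloc`, the scheme's `Regime` and analyticity letters,
the domain condition on `B`), symmetry of `d`, the row sums (2.61) at the knitting rate `σ` (`τ ≥ 0`, `σ + τ ≤ ⅛δ₀`, `δ ≤ τ`) and at
`½δ`, the [16]-side letters (source size against (190)'s constant `K = const190 …`, support `S` of the argument, multiplicity `m`,
J-side letters, `hne`), r13's chain inputs and `hdist`, and the box count `|S| ≤ C_γM⁴R_k⁵`.
[cite: Balaban1989LargeFieldII, (1.47) p.368; Balaban1985Variational, Prop. 9 (190) pp.308–309, (179)–(180) p.306; Balaban1984PropagatorsII, Lemma 2.1 (2.61) p.234] -/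
theorem ineq147_sectG_rowSum (R : Regime 𝒢 0 W B₀ θ C₄ a₃ j a ε₄) (hWa : AnalyticOnNhd ℂ W {Y : 𝒴 | ‖Y‖ < a₃})
    {D : 𝒴 → 𝒳} (H : 𝒳 →L[ℂ] 𝒴) (hTm : AnalyticOnNhd ℂ (fun Y : 𝒴 => Y - H (D Y)) {Y : 𝒴 | ‖Y‖ < ε₄ + a})
    (hTm0 : (0 : 𝒴) - H (D 0) = 0)
    {B : 𝒳} (hB : ‖H₀ B‖ < a ∧ ‖D2 (H₀ B)‖ < j)
    (ev : X → (𝒴 →L[ℝ] E))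
    {bB : BlockNorm g 𝒳} {bN : BlockNorm g 𝒴} {b3 : BlockNorm g 𝒵}
    (hev : ∀ (y : g.Site) (v : 𝒴), ∀ x ∈ box y, ‖ev x v‖ ≤ bN.loc y v)
    (hN : ∀ (y : g.Site) (v : 𝒴), bN.loc y v ≤ ‖v‖) (hBloc : ∀ (y' : g.Site) (μ : 𝒳), bB.IsLoc y' μ → ‖μ‖ ≤ bB.loc y' μ)
    {δ₀ BG θW cΔ A₀ AH θD c : ℝ}
    (htri : Triangle254 g) (hd : ∀ a b : g.Site, 0 ≤ g.dist a b) (hsymm : ∀ a b : g.Site, g.dist a b = g.dist b a)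
    (hδ₀ : 0 ≤ δ₀)
    (hc : 0 ≤ c) (hBG : 0 ≤ BG) (hθW : 0 ≤ θW) (hcΔ : 0 ≤ cΔ) (hA₀ : 0 ≤ A₀) (hAH : 0 ≤ AH) (hθD : 0 ≤ θD)
    (hG : HasMaj b3 bN (𝒢.restrictScalars ℝ : 𝒵 →ₗ[ℝ] 𝒴) (fun y y' => BG * Real.exp (-(δ₀ * g.dist y y'))))
    (hD2H0 : HasMaj bB b3 ((D2 ∘L H₀).restrictScalars ℝ : 𝒳 →ₗ[ℝ] 𝒵) (fun y y' => cΔ * Real.exp (-(δ₀ * g.dist y y'))))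
    (hH0 : HasMaj bB bN (H₀.restrictScalars ℝ : 𝒳 →ₗ[ℝ] 𝒴) (fun y y' => A₀ * Real.exp (-(δ₀ * g.dist y y'))))
    (hH : HasMaj bB bN (H.restrictScalars ℝ : 𝒳 →ₗ[ℝ] 𝒴) (fun y y' => AH * Real.exp (-(δ₀ / 2 * g.dist y y'))))
    (h189 : ∀ B' : 𝒳, ‖H₀ B'‖ < a → ‖D2 (H₀ B')‖ < j →
      Ineq189 bN b3 ((fderiv ℂ W (solA180 𝒢 W D2 H₀ ε₄ B' + H₀ B')).restrictScalars ℝ : 𝒴 →ₗ[ℝ] 𝒵) θW δ₀)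
    (hDfr : ∀ B' : 𝒳, ‖H₀ B'‖ < a → ‖D2 (H₀ B')‖ < j →
      ∃ 𝔇 : 𝒴 →L[ℂ] 𝒳, HasFDerivAt D 𝔇 (solA180 𝒢 W D2 H₀ ε₄ B' + H₀ B') ∧
        HasMaj bN bB (𝔇.restrictScalars ℝ : 𝒴 →ₗ[ℝ] 𝒳) (fun y y' => θD * Real.exp (-(δ₀ / 2 * g.dist y y'))))
    (hq : qG b3.κ bN.κ BG θW c < 1)
    -- the [16] side
    {σ τ c₂ B₃ δ C Linv B₅ M alpha gk C' εk β₀ C₁ q₁g A0' p₀g Rk Cγ : ℝ} {N k h : ℕ} {ε : ℕ → ℝ} {Γ : ℕ → Finset X}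
    {dist : X → ℝ}
    (hrow : RowSum g σ c) (hrow₂ : RowSum g (δ / 2) c₂) (hτ : 0 ≤ τ) (hστ : σ + τ ≤ δ₀ / 8) (hδτ : δ ≤ τ)
    (hm : ∀ y', bB.loc y' B < C * Linv ^ N * B₃ ^ 2 * B₅ * M ^ 6 * alpha)
    {S : Finset g.Site} (hSupp : ∀ y', bB.loc y' B ≠ 0 → y' ∈ S)
    (hCB : const190 bB.κ bN.κ b3.κ BG θW cΔ A₀ AH θD c * bB.κ * c ≤ B₃) (hB₃ : 0 < B₃)
    {yOf : ℕ → X → g.Site} {nJ s : ℕ → X → ℝ} {m : ℕ}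
    (hx : ∀ j ∈ Icc 1 h, ∀ x ∈ Γ j, x ∈ box (yOf j x))
    (hmult : ∀ j ∈ Icc 1 h, ∀ y : g.Site, #{x ∈ Γ j | yOf j x = y} ≤ m)
    (hdistS : ∀ j ∈ Icc 1 h, ∀ x ∈ Γ j, ∀ y' ∈ S, dist x ≤ g.dist (yOf j x) y')
    (hdistS' : ∀ j ∈ Icc 1 h, ∀ x ∈ Γ j, ∃ y' ∈ S, g.dist (yOf j x) y' ≤ dist x)
    (hJ : ∀ j ∈ Icc 1 h, ∀ x ∈ Γ j, nJ j x ≤ ((gk ^ 2)⁻¹ + C' * ((k : ℝ) - j)) * ε j)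
    (hJnn : ∀ j ∈ Icc 1 h, ∀ x ∈ Γ j, 0 ≤ nJ j x)
    (hJpos : ∀ j ∈ Icc 1 h, (Γ j).Nonempty → 0 < ((gk ^ 2)⁻¹ + C' * ((k : ℝ) - j)) * ε j)
    (hpair : ∀ j ∈ Icc 1 h, ∀ x ∈ Γ j,
      |s j x| ≤ ‖ev x (chartH179 𝒢 W D2 H₀ (fun Y : 𝒴 => Y - H (D Y)) ε₄ B)‖ * nJ j x)
    (hne : ∃ j ∈ Icc 1 h, (Γ j).Nonempty)
    -- r13's chain inputs, verbatim except `hS` (now derived)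
    (hC : 0 ≤ C) (hLinv : 0 ≤ Linv) (hB₅ : 0 ≤ B₅) (hα : 0 ≤ alpha)
    (hgk : 0 < gk) (hgk1 : gk ≤ 1) (hC' : 0 ≤ C') (hεk : 0 ≤ εk) (hδ : 0 ≤ δ) (hβ₀ : 0 ≤ β₀)
    (hβ₁ : β₀ ≤ 1) (hN1 : 1 ≤ N) (hk : k = h + N) (hδM : 6 ≤ δ * M)
    (hdist : ∀ j ∈ Icc 1 h, ∀ x ∈ Γ j, M * ((h : ℝ) - j) ≤ dist x)
    (hε : ∀ j ∈ Icc 1 h, ε j ≤ (1 + β₀) ^ 2 * ((k : ℝ) - j) ^ β₀ * εk)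
    (hαeq : alpha = C₁ * gk * q₁g) (hεeq : εk = gk * A0' * p₀g) (hNW : B16Sect1Kernels.NWindowUpper N Rk)
    (hΓ : (#S : ℝ) ≤ Cγ * M ^ 4 * Rk ^ 5) :
    B16Sect1Statements.Ineq147 (∑ j ∈ Icc 1 h, ∑ x ∈ Γ j, s j x)
      ((C * (1 + C') * (1 + β₀) ^ 2 * (2 * (m * c₂))) * Cγ) A0' C₁ B₃ B₅ M p₀g q₁g Rk Linv N := by
  obtain ⟨j₀, hj₀, x₀, hx₀⟩ := hne
  obtain ⟨y₁, hy₁, _⟩ := hdistS' j₀ hj₀ x₀ hx₀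
  have hSne : S.Nonempty := ⟨y₁, hy₁⟩
  set Dd : g.Site → ℝ := fun y => S.inf' hSne (fun y' => g.dist y y') with hDd
  have hD : ∀ y y', bB.loc y' B ≠ 0 → Dd y ≤ g.dist y y' := fun y y' hy' =>
    Finset.inf'_le (fun y'' => g.dist y y'') (hSupp y' hy')
  have hgeom : ∀ j ∈ Icc 1 h, ∀ x ∈ Γ j, δ * dist x ≤ τ * Dd (yOf j x) := by
    intro j hj x hx
    have hle : dist x ≤ Dd (yOf j x) := (Finset.le_inf'_iff hSne _).mpr (hdistS j hj x hx)
    obtain ⟨y', _, hy'⟩ := hdistS' j hj x hx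
    have h0 : 0 ≤ dist x := (hd _ _).trans hy'
    calc δ * dist x ≤ τ * dist x := mul_le_mul_of_nonneg_right hδτ h0
      _ ≤ τ * Dd (yOf j x) := mul_le_mul_of_nonneg_left hle hτ
  have hfirst := ineq147First_sectG (box := box) R hWa H hTm hTm0 hB ev hev hN hBloc htri hd hδ₀ hc hBG hθW hcΔ hA₀ hAH
    hθD hG hD2H0 hH0 hH h189 hDfr hq hrow hτ hστ hm hD hCB hB₃ hx hgeom hJ hJnn hJpos hpair ⟨j₀, hj₀, x₀, hx₀⟩
  have hc₂ : 0 ≤ c₂ := hrow₂.nonneg (yOf j₀ x₀)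
  exact ineq147_of_first_count hfirst hB₃.le hC hLinv hB₅ hα hgk hgk1 hC' hεk hδ hβ₀ hβ₁ hN1 hk hδM hdist hε hαeq hεeq
    hNW (by positivity) (Nat.cast_nonneg _) (hcount_of_rowSum hrow₂ hsymm hδ Γ yOf hmult S hdistS') hΓ

end SectG

/-! ## §5 (v1.1, append-only). The separation `hdist` from the walk form of (2.2)/(1.12) (level gaps) -/

section LevelGap

open B6Geometry

variable {FB FA : Type} [AddCommGroup FB] [Module ℝ FB] [AddCommGroup FA] [Module ℝ FA] {C : ContourSystem g}

omit [DecidableEq g.Site] in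
/-- **The separation `hdist` of (1.47) FROM THE LEVEL GAPS.**  For a geometry realised by a contour system (`Realizes g C`,
admissible contours exist) with the walk form of (2.2)/(1.12) `LevelGap C.bond C.zone N`: if the blocks `y′ ∈ S` carrying the
argument have scale `g.scale y′ ≥ h + 1` (*«support in the domain Ω″^{~2}_{h+1} ∩ Z″_{h+2}»*), the block `yOf j x` of every
`x ∈ Γ″_j` has scale `≤ j` (`Γ″_j = (Ω″_j∖Ω″_{j+1})^{(j)}`, (1.13) [IV]), and `dist x ≥ d(yOf j x, y′)` for some `y′ ∈ S`, then
`M(h − j) ≤ dist x` on `Γ″_j`, `j = 1, …, h`, for every `M ≤ N` — r13's hypothesis `hdist` *«d(x, Ω″^{~2}_{h+1}) ≧ M(h − j)»*, by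
`B6Geometry.levelGap_dist` (`N·(zone y′ − zone y − 1) ≤ d(y, y′)`). [cite: Balaban1989LargeFieldII, (1.47) p.368; Balaban1989LargeFieldI, (1.12)–(1.13) p.179; Balaban1984PropagatorsII, (2.2) p.224, (2.60) p.234] -/
theorem hdist_of_levelGap (hreal : Realizes g C) (hconn : C.bond.Connected) {N : ℕ} (hgap : LevelGap C.bond C.zone N)
    {h : ℕ} {Γ : ℕ → Finset α} {yOf : ℕ → α → g.Site} {S : Finset g.Site} {dist : α → ℝ} {M : ℝ}
    (hzoneS : ∀ y' ∈ S, h + 1 ≤ g.scale y') (hzoneΓ : ∀ j ∈ Icc 1 h, ∀ x ∈ Γ j, g.scale (yOf j x) ≤ j)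
    (hdistS' : ∀ j ∈ Icc 1 h, ∀ x ∈ Γ j, ∃ y' ∈ S, g.dist (yOf j x) y' ≤ dist x) (hMN : M ≤ N) :
    ∀ j ∈ Icc 1 h, ∀ x ∈ Γ j, M * ((h : ℝ) - j) ≤ dist x := by
  intro j hj x hx
  obtain ⟨y', hy', hle⟩ := hdistS' j hj x hx
  have hjh : j ≤ h := (mem_Icc.mp hj).2
  have hzy : C.zone (C.ι (yOf j x)) ≤ j := by rw [C.zone_ι]; exact hzoneΓ j hj x hx
  have hzy' : h + 1 ≤ C.zone (C.ι y') := by rw [C.zone_ι]; exact hzoneS y' hy'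
  have hlt : C.zone (C.ι (yOf j x)) < C.zone (C.ι y') := by omega
  have hgapN := levelGap_dist hconn hgap hlt
  -- `N·(h − j) ≤ N·(zone y′ − zone y − 1) ≤ d(y, y′)` as naturals, then cast
  have hnat : N * (h - j) ≤ C.bond.dist (C.ι (yOf j x)) (C.ι y') :=
    le_trans (Nat.mul_le_mul_left N (by omega)) hgapN
  have hreal' : g.dist (yOf j x) y' = (C.bond.dist (C.ι (yOf j x)) (C.ι y') : ℝ) := hreal _ _
  have hcast : (N : ℝ) * ((h : ℝ) - j) ≤ g.dist (yOf j x) y' := by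
    rw [hreal']
    have e : ((h - j : ℕ) : ℝ) = (h : ℝ) - j := Nat.cast_sub hjh
    have := (Nat.cast_le (α := ℝ)).mpr hnat
    push_cast at this
    rw [e] at this
    exact this
  have hhj : (0 : ℝ) ≤ (h : ℝ) - j := by
    have : (j : ℝ) ≤ h := by exact_mod_cast hjh
    linarith
  calc M * ((h : ℝ) - j) ≤ (N : ℝ) * ((h : ℝ) - j) := mul_le_mul_of_nonneg_right hMN hhj
    _ ≤ g.dist (yOf j x) y' := hcast
    _ ≤ dist x := hle

/-- **(1.47) p. 368 FROM [15] (190), THE COUNT BY (2.61) AND THE SEPARATION BY THE LEVEL GAPS** — §3's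
`ineq147_of_ineq190_rowSum` for a geometry REALISED by a contour system with the walk form of (2.2)/(1.12) (`Realizes`,
`Connected`, `LevelGap C.bond C.zone N`), with `hdist` DISCHARGED by `hdist_of_levelGap` from the zone data (`hzoneS`: support
blocks of scale `≥ h + 1`; `hzoneΓ`: blocks of `Γ″_j` of scale `≤ j`; `M ≤ N`) and the symmetry / non-negativity of `d` by
`Realizes` (`dist_comm_of_realizes`, `dist_nonneg_of_realizes`): the geometric inputs of (1.47) — count, dictionary of the distance,
separation — are now all derived; what is carried is (190), the two row sums (2.61), `hmv`, the source size and support, the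
multiplicity, the J-side letters, `hne`, r13's arithmetic inputs ((2.8)[III] third member, `k = h + N′`, `N′ ≤ R_k`, dictionary,
`δM ≧ 6`) and the box count `|S| ≦ C_γM⁴R_k⁵`.
[cite: Balaban1989LargeFieldII, (1.47) p.368; Balaban1985Variational, Prop. 9 (190) pp.308–309; Balaban1984PropagatorsII, Lemma 2.1 (2.61) p.234, (2.2) p.224; Balaban1989LargeFieldI, (1.12)–(1.13) p.179] -/
theorem ineq147_of_ineq190_levelGap {T : Type*} {bB : BlockNorm g FB} {bout : BlockNorm g FA} {dH : T → FB →ₗ[ℝ] FA}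
    {Cc δ₀ σ τ c c₂ B₃ δ C₀ Linv B₅ M alpha gk C' εk β₀ C₁ q₁g A₀ p₀g Rk Cγ : ℝ} {N k h Ngap : ℕ} {ε : ℕ → ℝ}
    {Γ : ℕ → Finset α} {dist : α → ℝ}
    (hreal : Realizes g C) (hconn : C.bond.Connected) (hgap : LevelGap C.bond C.zone Ngap)
    (h190 : ∀ t, Ineq190 bB bout (dH t) Cc δ₀) (hCc : 0 ≤ Cc)
    (hrow : RowSum g σ c) (hrow₂ : RowSum g (δ / 2) c₂)
    (hτ : 0 ≤ τ) (hστ : σ + τ ≤ δ₀ / 8) (hδτ : δ ≤ τ) (B : FB) {HB : FA}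
    (hmv : ∀ (y : g.Site) (s : ℝ), (∀ t, bout.loc y (dH t B) ≤ s) → bout.loc y HB ≤ s)
    (hm : ∀ y', bB.loc y' B < C₀ * Linv ^ N * B₃ ^ 2 * B₅ * M ^ 6 * alpha)
    {S : Finset g.Site} (hSupp : ∀ y', bB.loc y' B ≠ 0 → y' ∈ S) (hzoneS : ∀ y' ∈ S, h + 1 ≤ g.scale y')
    (hCB : Cc * bB.κ * c ≤ B₃) (hB₃ : 0 < B₃)
    {yOf : ℕ → α → g.Site} {nf : α → ℝ} {nJ s : ℕ → α → ℝ} {m : ℕ}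
    (hzoneΓ : ∀ j ∈ Icc 1 h, ∀ x ∈ Γ j, g.scale (yOf j x) ≤ j)
    (hmult : ∀ j ∈ Icc 1 h, ∀ y : g.Site, #{x ∈ Γ j | yOf j x = y} ≤ m)
    (hdistS : ∀ j ∈ Icc 1 h, ∀ x ∈ Γ j, ∀ y' ∈ S, dist x ≤ g.dist (yOf j x) y')
    (hdistS' : ∀ j ∈ Icc 1 h, ∀ x ∈ Γ j, ∃ y' ∈ S, g.dist (yOf j x) y' ≤ dist x)
    (hdom : ∀ j ∈ Icc 1 h, ∀ x ∈ Γ j, nf x ≤ bout.loc (yOf j x) HB)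
    (hJ : ∀ j ∈ Icc 1 h, ∀ x ∈ Γ j, nJ j x ≤ ((gk ^ 2)⁻¹ + C' * ((k : ℝ) - j)) * ε j)
    (hJnn : ∀ j ∈ Icc 1 h, ∀ x ∈ Γ j, 0 ≤ nJ j x)
    (hJpos : ∀ j ∈ Icc 1 h, (Γ j).Nonempty → 0 < ((gk ^ 2)⁻¹ + C' * ((k : ℝ) - j)) * ε j)
    (hpair : ∀ j ∈ Icc 1 h, ∀ x ∈ Γ j, |s j x| ≤ nf x * nJ j x)
    (hne : ∃ j ∈ Icc 1 h, (Γ j).Nonempty) {Tval : ℝ} (hT : Tval = ∑ j ∈ Icc 1 h, ∑ x ∈ Γ j, s j x)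
    (hC : 0 ≤ C₀) (hLinv : 0 ≤ Linv) (hB₅ : 0 ≤ B₅) (hα : 0 ≤ alpha)
    (hgk : 0 < gk) (hgk1 : gk ≤ 1) (hC' : 0 ≤ C') (hεk : 0 ≤ εk) (hδ : 0 ≤ δ) (hβ₀ : 0 ≤ β₀)
    (hβ₁ : β₀ ≤ 1) (hN : 1 ≤ N) (hk : k = h + N) (hδM : 6 ≤ δ * M) (hMN : M ≤ Ngap)
    (hε : ∀ j ∈ Icc 1 h, ε j ≤ (1 + β₀) ^ 2 * ((k : ℝ) - j) ^ β₀ * εk)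
    (hαeq : alpha = C₁ * gk * q₁g) (hεeq : εk = gk * A₀ * p₀g) (hNW : B16Sect1Kernels.NWindowUpper N Rk)
    (hΓ : (#S : ℝ) ≤ Cγ * M ^ 4 * Rk ^ 5) :
    B16Sect1Statements.Ineq147 Tval ((C₀ * (1 + C') * (1 + β₀) ^ 2 * (2 * (m * c₂))) * Cγ) A₀ C₁ B₃ B₅ M p₀g q₁g
      Rk Linv N :=
  ineq147_of_ineq190_rowSum h190 hCc (dist_nonneg_of_realizes hreal) (dist_comm_of_realizes hreal) hrow hrow₂ hτ hστ hδτ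
    B hmv hm hSupp hCB hB₃ hmult hdistS hdistS' hdom hJ hJnn hJpos hpair hne hT hC hLinv hB₅ hα hgk hgk1 hC' hεk hδ hβ₀
    hβ₁ hN hk hδM (hdist_of_levelGap hreal hconn hgap hzoneS hzoneΓ hdistS' hMN) hε hαeq hεeq hNW hΓ

end LevelGap

/-! ## §6 (v1.2, append-only). BOTH ROW SUMS DISCHARGED: (1.47) on realised geometries with bond scales and packing -/

section Packing

open B6Geometry B6LevelGapMetric B6Ineq261LevelGap

variable {FB FA : Type} [AddCommGroup FB] [Module ℝ FB] [AddCommGroup FA] [Module ℝ FA] {C : ContourSystem g}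
  {X : Type*} [PseudoMetricSpace X] {pos : C.Pt → X} {ℓ : ℕ → ℝ} {dd : ℕ} {Lr A : ℝ}

/-- **(1.47) p. 368 BY NAME with EVERY geometric input a theorem of the realised contour system.**  As §5's
`ineq147_of_ineq190_levelGap` (count from (2.61), dictionary of the distance, separation from the level gaps) with, in addition,
BOTH ROW SUMS — (2.61) at the knitting rate `σ` and at `½δ` — DISCHARGED by `B6Ineq261LevelGap.rowSum_K261_of_realizes`
([B6] Lemma 2.1 (2.61) proved for realised contour systems): the geometry now enters ONLY through `Realizes g C` (`C.ι` injective,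
admissible contours exist), the walk form `LevelGap C.bond C.zone Ngap` (`Ngap ≥ 1`) of (2.2) [B6] / (1.12) [IV], the bond scales
`BondScale C.bond C.zone pos ℓ` (`0 < ℓ n ≤ ℓ(n+1) ≤ L·ℓ n`, `L ≥ 1`: *«a part of Γ contained in B^j(Λ_j) consists of bonds of the
lattice Λ_j»*, [B6] p. 231) and the per-scale packing of the lattices `Λ_j`; the constants of the two row sums are the series
constants `K261 Ngap dd L A σ` and `K261 Ngap dd L A (δ/2)`, finite under `e^{−σ}L^{2dd/Ngap} < 1` and `e^{−δ/2}L^{2dd/Ngap} < 1`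
(the (2.59)-shape conditions).  Carried: (190), `hmv`, the source size and support, the multiplicity, the J-side letters, `hne`,
r13's arithmetic inputs and the box count, as in §5.
[cite: Balaban1989LargeFieldII, (1.47) p.368; Balaban1985Variational, Prop. 9 (190) pp.308–309; Balaban1984PropagatorsII, Lemma 2.1 (2.61) p.234, (2.2) p.224, p.231; Balaban1989LargeFieldI, (1.12)–(1.13) p.179] -/
theorem ineq147_of_ineq190_packing {T : Type*} {bB : BlockNorm g FB} {bout : BlockNorm g FA} {dH : T → FB →ₗ[ℝ] FA}
    {Cc δ₀ σ τ B₃ δ C₀ Linv B₅ M alpha gk C' εk β₀ C₁ q₁g A₀ p₀g Rk Cγ : ℝ} {N k h Ngap : ℕ} {ε : ℕ → ℝ}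
    {Γ : ℕ → Finset α} {dist : α → ℝ}
    (hreal : Realizes g C) (hι : Function.Injective C.ι) (hconn : C.bond.Connected)
    (hgap : LevelGap C.bond C.zone Ngap) (hNgap : 0 < Ngap)
    (hbond : BondScale C.bond C.zone pos ℓ) (hmono : Monotone ℓ) (hℓpos : ∀ n, 0 < ℓ n)
    (hℓL : ∀ n, ℓ (n + 1) ≤ Lr * ℓ n) (hLr : 1 ≤ Lr) (hA : 0 ≤ A)
    (hpack : ∀ (j : ℕ) (p : X) (R : ℝ) (S : Finset C.Pt), 0 ≤ R →
      (∀ v ∈ S, C.zone v = j ∧ Dist.dist (pos v) p ≤ R) → (#S : ℝ) ≤ (2 * R / ℓ j + A) ^ dd)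
    (hθσ : Real.exp (-σ) * Lr ^ ((2 * dd : ℝ) / Ngap) < 1)
    (hθδ : Real.exp (-(δ / 2)) * Lr ^ ((2 * dd : ℝ) / Ngap) < 1)
    (h190 : ∀ t, Ineq190 bB bout (dH t) Cc δ₀) (hCc : 0 ≤ Cc)
    (hτ : 0 ≤ τ) (hστ : σ + τ ≤ δ₀ / 8) (hδτ : δ ≤ τ) (B : FB) {HB : FA}
    (hmv : ∀ (y : g.Site) (s : ℝ), (∀ t, bout.loc y (dH t B) ≤ s) → bout.loc y HB ≤ s)
    (hm : ∀ y', bB.loc y' B < C₀ * Linv ^ N * B₃ ^ 2 * B₅ * M ^ 6 * alpha)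
    {S : Finset g.Site} (hSupp : ∀ y', bB.loc y' B ≠ 0 → y' ∈ S) (hzoneS : ∀ y' ∈ S, h + 1 ≤ g.scale y')
    (hCB : Cc * bB.κ * K261 Ngap dd Lr A σ ≤ B₃) (hB₃ : 0 < B₃)
    {yOf : ℕ → α → g.Site} {nf : α → ℝ} {nJ s : ℕ → α → ℝ} {m : ℕ}
    (hzoneΓ : ∀ j ∈ Icc 1 h, ∀ x ∈ Γ j, g.scale (yOf j x) ≤ j)
    (hmult : ∀ j ∈ Icc 1 h, ∀ y : g.Site, #{x ∈ Γ j | yOf j x = y} ≤ m)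
    (hdistS : ∀ j ∈ Icc 1 h, ∀ x ∈ Γ j, ∀ y' ∈ S, dist x ≤ g.dist (yOf j x) y')
    (hdistS' : ∀ j ∈ Icc 1 h, ∀ x ∈ Γ j, ∃ y' ∈ S, g.dist (yOf j x) y' ≤ dist x)
    (hdom : ∀ j ∈ Icc 1 h, ∀ x ∈ Γ j, nf x ≤ bout.loc (yOf j x) HB)
    (hJ : ∀ j ∈ Icc 1 h, ∀ x ∈ Γ j, nJ j x ≤ ((gk ^ 2)⁻¹ + C' * ((k : ℝ) - j)) * ε j)
    (hJnn : ∀ j ∈ Icc 1 h, ∀ x ∈ Γ j, 0 ≤ nJ j x)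
    (hJpos : ∀ j ∈ Icc 1 h, (Γ j).Nonempty → 0 < ((gk ^ 2)⁻¹ + C' * ((k : ℝ) - j)) * ε j)
    (hpair : ∀ j ∈ Icc 1 h, ∀ x ∈ Γ j, |s j x| ≤ nf x * nJ j x)
    (hne : ∃ j ∈ Icc 1 h, (Γ j).Nonempty) {Tval : ℝ} (hT : Tval = ∑ j ∈ Icc 1 h, ∑ x ∈ Γ j, s j x)
    (hC : 0 ≤ C₀) (hLinv : 0 ≤ Linv) (hB₅ : 0 ≤ B₅) (hα : 0 ≤ alpha)
    (hgk : 0 < gk) (hgk1 : gk ≤ 1) (hC' : 0 ≤ C') (hεk : 0 ≤ εk) (hδ : 0 ≤ δ) (hβ₀ : 0 ≤ β₀)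
    (hβ₁ : β₀ ≤ 1) (hN : 1 ≤ N) (hk : k = h + N) (hδM : 6 ≤ δ * M) (hMN : M ≤ Ngap)
    (hε : ∀ j ∈ Icc 1 h, ε j ≤ (1 + β₀) ^ 2 * ((k : ℝ) - j) ^ β₀ * εk)
    (hαeq : alpha = C₁ * gk * q₁g) (hεeq : εk = gk * A₀ * p₀g) (hNW : B16Sect1Kernels.NWindowUpper N Rk)
    (hΓ : (#S : ℝ) ≤ Cγ * M ^ 4 * Rk ^ 5) :
    B16Sect1Statements.Ineq147 Tval ((C₀ * (1 + C') * (1 + β₀) ^ 2 * (2 * (m * K261 Ngap dd Lr A (δ / 2)))) * Cγ) A₀ C₁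
      B₃ B₅ M p₀g q₁g Rk Linv N :=
  ineq147_of_ineq190_levelGap hreal hconn hgap h190 hCc
    (rowSum_K261_of_realizes hreal hι hconn hgap hNgap hbond hmono hℓpos hℓL hLr hA hpack hθσ)
    (rowSum_K261_of_realizes hreal hι hconn hgap hNgap hbond hmono hℓpos hℓL hLr hA hpack hθδ)
    hτ hστ hδτ B hmv hm hSupp hzoneS hCB hB₃ hzoneΓ hmult hdistS hdistS' hdom hJ hJnn hJpos hpair hne hT hC hLinv hB₅ hα
    hgk hgk1 hC' hεk hδ hβ₀ hβ₁ hN hk hδM hMN hε hαeq hεeq hNW hΓ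

end Packing

section CubeSites

open B6Geometry B6Ineq261LevelGap B15Ineq147LevelGap

variable {FB FA : Type} [AddCommGroup FB] [Module ℝ FB] [AddCommGroup FA] [Module ℝ FA]
  {d M₁ L : ℕ} {Z : ℕ → Set (Fin d → ℤ)}

/-- **(1.47) p. 368 BY NAME on the ℤᵈ CUBE-SITE MODEL** of `B15Ineq147LevelGap` (sites = `M₁`-cubes on corresponding scales in
the layers of nested `Z″_n ⊂ ℤᵈ`, `CubeSite M₁ L Z`, zones `zoneC`, corners `posC`, scales `scaleC M₁ L`): for a geometry `g` whose
distance is the contour distance of ANY bond graph `G` on the cube-sites with bonds within the coarser scale (touching cubes of equal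
or consecutive scales qualify), given its walk form `LevelGap G zoneC Ngap` (`Ngap ≥ 1`) and connectedness, EVERY geometric input
of (1.47) — both row sums (`B6Ineq261LevelGap.rowSum_cubeSites`), the count, the dictionary, the separation — is a theorem;
constants `K261 Ngap d L 1 σ`, `K261 Ngap d L 1 (δ/2)` under `e^{−σ}L^{2d/Ngap} < 1`, `e^{−δ/2}L^{2d/Ngap} < 1`, `M₁ ≥ 1`, `L ≥ 1`.
[cite: Balaban1989LargeFieldII, (1.47) p.368; Balaban1985Variational, Prop. 9 (190) pp.308–309; Balaban1984PropagatorsII, Lemma 2.1 (2.61) p.234; Balaban1989LargeFieldI, (1.12)–(1.13) p.179, p.186] -/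
theorem ineq147_of_ineq190_cubeSites {T : Type*} {bB : BlockNorm g FB} {bout : BlockNorm g FA} {dH : T → FB →ₗ[ℝ] FA}
    {Cc δ₀ σ τ B₃ δ C₀ Linv B₅ M alpha gk C' εk β₀ C₁ q₁g A₀ p₀g Rk Cγ : ℝ} {N k h Ngap : ℕ} {ε : ℕ → ℝ}
    {Γ : ℕ → Finset α} {dist : α → ℝ}
    (G : SimpleGraph (CubeSite M₁ L Z)) (ι : g.Site → CubeSite M₁ L Z) (hι : Function.Injective ι)
    (hzone : ∀ y, zoneC (ι y) = g.scale y) (hdistG : ∀ y y', g.dist y y' = (G.dist (ι y) (ι y') : ℝ)) (hconn : G.Connected)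
    (hgap : LevelGap G zoneC Ngap) (hNgap : 0 < Ngap)
    (hadj : ∀ ⦃u v : CubeSite M₁ L Z⦄, G.Adj u v → Dist.dist (posC u) (posC v) ≤ scaleC M₁ L (max (zoneC u) (zoneC v)))
    (hM₁ : 0 < M₁) (hL : 1 ≤ L)
    (hθσ : Real.exp (-σ) * (L : ℝ) ^ ((2 * d : ℝ) / Ngap) < 1)
    (hθδ : Real.exp (-(δ / 2)) * (L : ℝ) ^ ((2 * d : ℝ) / Ngap) < 1)
    (h190 : ∀ t, Ineq190 bB bout (dH t) Cc δ₀) (hCc : 0 ≤ Cc)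
    (hτ : 0 ≤ τ) (hστ : σ + τ ≤ δ₀ / 8) (hδτ : δ ≤ τ) (B : FB) {HB : FA}
    (hmv : ∀ (y : g.Site) (s : ℝ), (∀ t, bout.loc y (dH t B) ≤ s) → bout.loc y HB ≤ s)
    (hm : ∀ y', bB.loc y' B < C₀ * Linv ^ N * B₃ ^ 2 * B₅ * M ^ 6 * alpha)
    {S : Finset g.Site} (hSupp : ∀ y', bB.loc y' B ≠ 0 → y' ∈ S) (hzoneS : ∀ y' ∈ S, h + 1 ≤ g.scale y')
    (hCB : Cc * bB.κ * K261 Ngap d L 1 σ ≤ B₃) (hB₃ : 0 < B₃)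
    {yOf : ℕ → α → g.Site} {nf : α → ℝ} {nJ s : ℕ → α → ℝ} {m : ℕ}
    (hzoneΓ : ∀ j ∈ Icc 1 h, ∀ x ∈ Γ j, g.scale (yOf j x) ≤ j)
    (hmult : ∀ j ∈ Icc 1 h, ∀ y : g.Site, #{x ∈ Γ j | yOf j x = y} ≤ m)
    (hdistS : ∀ j ∈ Icc 1 h, ∀ x ∈ Γ j, ∀ y' ∈ S, dist x ≤ g.dist (yOf j x) y')
    (hdistS' : ∀ j ∈ Icc 1 h, ∀ x ∈ Γ j, ∃ y' ∈ S, g.dist (yOf j x) y' ≤ dist x)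
    (hdom : ∀ j ∈ Icc 1 h, ∀ x ∈ Γ j, nf x ≤ bout.loc (yOf j x) HB)
    (hJ : ∀ j ∈ Icc 1 h, ∀ x ∈ Γ j, nJ j x ≤ ((gk ^ 2)⁻¹ + C' * ((k : ℝ) - j)) * ε j)
    (hJnn : ∀ j ∈ Icc 1 h, ∀ x ∈ Γ j, 0 ≤ nJ j x)
    (hJpos : ∀ j ∈ Icc 1 h, (Γ j).Nonempty → 0 < ((gk ^ 2)⁻¹ + C' * ((k : ℝ) - j)) * ε j)
    (hpair : ∀ j ∈ Icc 1 h, ∀ x ∈ Γ j, |s j x| ≤ nf x * nJ j x)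
    (hne : ∃ j ∈ Icc 1 h, (Γ j).Nonempty) {Tval : ℝ} (hT : Tval = ∑ j ∈ Icc 1 h, ∑ x ∈ Γ j, s j x)
    (hC : 0 ≤ C₀) (hLinv : 0 ≤ Linv) (hB₅ : 0 ≤ B₅) (hα : 0 ≤ alpha)
    (hgk : 0 < gk) (hgk1 : gk ≤ 1) (hC' : 0 ≤ C') (hεk : 0 ≤ εk) (hδ : 0 ≤ δ) (hβ₀ : 0 ≤ β₀)
    (hβ₁ : β₀ ≤ 1) (hN : 1 ≤ N) (hk : k = h + N) (hδM : 6 ≤ δ * M) (hMN : M ≤ Ngap)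
    (hε : ∀ j ∈ Icc 1 h, ε j ≤ (1 + β₀) ^ 2 * ((k : ℝ) - j) ^ β₀ * εk)
    (hαeq : alpha = C₁ * gk * q₁g) (hεeq : εk = gk * A₀ * p₀g) (hNW : B16Sect1Kernels.NWindowUpper N Rk)
    (hΓ : (#S : ℝ) ≤ Cγ * M ^ 4 * Rk ^ 5) :
    B16Sect1Statements.Ineq147 Tval ((C₀ * (1 + C') * (1 + β₀) ^ 2 * (2 * (m * K261 Ngap d L 1 (δ / 2)))) * Cγ) A₀ C₁
      B₃ B₅ M p₀g q₁g Rk Linv N := by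
  let Cs : ContourSystem g := ⟨CubeSite M₁ L Z, G, ι, zoneC, hzone⟩
  have hreal : Realizes g Cs := fun y y' => hdistG y y'
  exact ineq147_of_ineq190_levelGap (C := Cs) hreal hconn hgap h190 hCc
    (rowSum_cubeSites G ι hι hzone hdistG hconn hgap hNgap hadj hM₁ hL hθσ)
    (rowSum_cubeSites G ι hι hzone hdistG hconn hgap hNgap hadj hM₁ hL hθδ)
    hτ hστ hδτ B hmv hm hSupp hzoneS hCB hB₃ hzoneΓ hmult hdistS hdistS' hdom hJ hJnn hJpos hpair hne hT hC hLinv hB₅ hα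
    hgk hgk1 hC' hεk hδ hβ₀ hβ₁ hN hk hδM hMN hε hαeq hεeq hNW hΓ

end CubeSites

/-! ## §7 (v1.3, append-only). The TOUCHING-CUBE contours: `hconn`, `hgap`, `hadj` discharged -/

section Touching

open B6Geometry B6Ineq261LevelGap B15Ineq147LevelGap B15TouchingCubeContours

variable {FB FA : Type} [AddCommGroup FB] [Module ℝ FB] [AddCommGroup FA] [Module ℝ FA]
  {d M₁ L MZ : ℕ} {Z : ℕ → Set (Fin d → ℤ)}

/-- **(1.47) p. 368 BY NAME for every geometry realised by TOUCHING-CUBE contours on the ℤᵈ cube carrier of [IV]** — §6's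
`ineq147_of_ineq190_cubeSites` with the bond graph fixed to `B15TouchingCubeContours.touchC M₁ L Z` (two cube-sites are joined
when their lattice cubes touch), whose three graph-theoretic inputs are now theorems: CONNECTEDNESS (`touchC_connected`, from the
covering `Tiles M₁ L Z` — every lattice point lies in the cube of a cube-site, (2.4) *«T = ⋃_j B^j(Λ_j)»*), the WALK FORM OF (2.2)
(`levelGap_touchC_sharp`: `LevelGap touchC zoneC (L·(M_Z/M₁) − 1)` from `Monotone Z″` and the one-layer separation
`LayerSepZd Z″ M_Z L`, *«separated by one layer of M-cubes»* p. 179 [IV]), and the COARSE-SIDE BONDS (`touchC_adj_dist`).  What is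
carried: the embedding `ι` of the blocks into the cube-sites with its zones, `g.dist` = the touching-contour distance, the printed
shape of `Z″` (`Monotone`, `LayerSepZd`, `Tiles`), `M₁ ≥ 1`, `L ≥ 1`, a level count `Ngap ≥ 1` with `Ngap + 1 ≤ L·(M_Z/M₁)`
(e.g. `Ngap = M_Z/M₁` for `L ≥ 2`), the (2.59)-shape conditions `e^{−σ}L^{2d/Ngap} < 1`, `e^{−δ/2}L^{2d/Ngap} < 1`, and §6's
analytic inputs verbatim ((190), `hmv`, source size/support, multiplicity, J-side letters, `hne`, r13's arithmetic inputs with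
`M ≤ Ngap`, the box count `|S| ≤ C_γM⁴R_k⁵`).
[cite: Balaban1989LargeFieldII, (1.47) p.368; Balaban1985Variational, Prop. 9 (190) pp.308–309; Balaban1984PropagatorsII, Lemma 2.1 (2.61) p.234, (2.2)–(2.4) p.224, (2.46) p.231; Balaban1989LargeFieldI, (1.12)–(1.13) p.179, p.186] -/
theorem ineq147_of_ineq190_touchC {T : Type*} {bB : BlockNorm g FB} {bout : BlockNorm g FA} {dH : T → FB →ₗ[ℝ] FA}
    {Cc δ₀ σ τ B₃ δ C₀ Linv B₅ M alpha gk C' εk β₀ C₁ q₁g A₀ p₀g Rk Cγ : ℝ} {N k h Ngap : ℕ} {ε : ℕ → ℝ}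
    {Γ : ℕ → Finset α} {dist : α → ℝ}
    (ι : g.Site → CubeSite M₁ L Z) (hι : Function.Injective ι)
    (hzone : ∀ y, zoneC (ι y) = g.scale y)
    (hdistG : ∀ y y', g.dist y y' = ((touchC M₁ L Z).dist (ι y) (ι y') : ℝ))
    (hmono : Monotone Z) (hsep : LayerSepZd Z MZ L) (htile : Tiles M₁ L Z) (hM₁ : 0 < M₁) (hL : 1 ≤ L)
    (hNgap : 0 < Ngap) (hNgapL : Ngap + 1 ≤ L * (MZ / M₁))
    (hθσ : Real.exp (-σ) * (L : ℝ) ^ ((2 * d : ℝ) / Ngap) < 1)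
    (hθδ : Real.exp (-(δ / 2)) * (L : ℝ) ^ ((2 * d : ℝ) / Ngap) < 1)
    (h190 : ∀ t, Ineq190 bB bout (dH t) Cc δ₀) (hCc : 0 ≤ Cc)
    (hτ : 0 ≤ τ) (hστ : σ + τ ≤ δ₀ / 8) (hδτ : δ ≤ τ) (B : FB) {HB : FA}
    (hmv : ∀ (y : g.Site) (s : ℝ), (∀ t, bout.loc y (dH t B) ≤ s) → bout.loc y HB ≤ s)
    (hm : ∀ y', bB.loc y' B < C₀ * Linv ^ N * B₃ ^ 2 * B₅ * M ^ 6 * alpha)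
    {S : Finset g.Site} (hSupp : ∀ y', bB.loc y' B ≠ 0 → y' ∈ S) (hzoneS : ∀ y' ∈ S, h + 1 ≤ g.scale y')
    (hCB : Cc * bB.κ * K261 Ngap d L 1 σ ≤ B₃) (hB₃ : 0 < B₃)
    {yOf : ℕ → α → g.Site} {nf : α → ℝ} {nJ s : ℕ → α → ℝ} {m : ℕ}
    (hzoneΓ : ∀ j ∈ Icc 1 h, ∀ x ∈ Γ j, g.scale (yOf j x) ≤ j)
    (hmult : ∀ j ∈ Icc 1 h, ∀ y : g.Site, #{x ∈ Γ j | yOf j x = y} ≤ m)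
    (hdistS : ∀ j ∈ Icc 1 h, ∀ x ∈ Γ j, ∀ y' ∈ S, dist x ≤ g.dist (yOf j x) y')
    (hdistS' : ∀ j ∈ Icc 1 h, ∀ x ∈ Γ j, ∃ y' ∈ S, g.dist (yOf j x) y' ≤ dist x)
    (hdom : ∀ j ∈ Icc 1 h, ∀ x ∈ Γ j, nf x ≤ bout.loc (yOf j x) HB)
    (hJ : ∀ j ∈ Icc 1 h, ∀ x ∈ Γ j, nJ j x ≤ ((gk ^ 2)⁻¹ + C' * ((k : ℝ) - j)) * ε j)
    (hJnn : ∀ j ∈ Icc 1 h, ∀ x ∈ Γ j, 0 ≤ nJ j x)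
    (hJpos : ∀ j ∈ Icc 1 h, (Γ j).Nonempty → 0 < ((gk ^ 2)⁻¹ + C' * ((k : ℝ) - j)) * ε j)
    (hpair : ∀ j ∈ Icc 1 h, ∀ x ∈ Γ j, |s j x| ≤ nf x * nJ j x)
    (hne : ∃ j ∈ Icc 1 h, (Γ j).Nonempty) {Tval : ℝ} (hT : Tval = ∑ j ∈ Icc 1 h, ∑ x ∈ Γ j, s j x)
    (hC : 0 ≤ C₀) (hLinv : 0 ≤ Linv) (hB₅ : 0 ≤ B₅) (hα : 0 ≤ alpha)
    (hgk : 0 < gk) (hgk1 : gk ≤ 1) (hC' : 0 ≤ C') (hεk : 0 ≤ εk) (hδ : 0 ≤ δ) (hβ₀ : 0 ≤ β₀)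
    (hβ₁ : β₀ ≤ 1) (hN : 1 ≤ N) (hk : k = h + N) (hδM : 6 ≤ δ * M) (hMN : M ≤ Ngap)
    (hε : ∀ j ∈ Icc 1 h, ε j ≤ (1 + β₀) ^ 2 * ((k : ℝ) - j) ^ β₀ * εk)
    (hαeq : alpha = C₁ * gk * q₁g) (hεeq : εk = gk * A₀ * p₀g) (hNW : B16Sect1Kernels.NWindowUpper N Rk)
    (hΓ : (#S : ℝ) ≤ Cγ * M ^ 4 * Rk ^ 5) :
    B16Sect1Statements.Ineq147 Tval ((C₀ * (1 + C') * (1 + β₀) ^ 2 * (2 * (m * K261 Ngap d L 1 (δ / 2)))) * Cγ) A₀ C₁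
      B₃ B₅ M p₀g q₁g Rk Linv N :=
  ineq147_of_ineq190_cubeSites (touchC M₁ L Z) ι hι hzone hdistG (touchC_connected htile hM₁ (by omega))
    (levelGap_of_le (levelGap_touchC_sharp hmono hsep hM₁ hL)
      (by generalize L * (MZ / M₁) = K at hNgapL; omega))
    hNgap (touchC_adj_dist hL) hM₁ hL hθσ hθδ h190 hCc hτ hστ hδτ B hmv hm hSupp hzoneS hCB hB₃ hzoneΓ hmult hdistS
    hdistS' hdom hJ hJnn hJpos hpair hne hT hC hLinv hB₅ hα hgk hgk1 hC' hεk hδ hβ₀ hβ₁ hN hk hδM hMN hε hαeq hεeq hNW hΓ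

/-- **The box count `|S| ≦ C_γM⁴R_k⁵` of (1.47) FROM AN EMBEDDING LETTER** (the last counting hypothesis `hΓ` of this
file's knits): a finite set `S` (of blocks, of any type) injected (`e`, injective on `S`) into a box `boxSites a n` of the
scale-`h` torus `T^{(j)}` of the cell's carrier `…Setup` with `n ≦ C_b·L·M·R_{h+1}` sites per direction — *«all the regions
connected with the last N steps are rectangular parallelepipeds»* contained in cubes of size `C_b·MR` ([IV] conditions (i)–(ii)
p. 177, p. 195; `C_b = 100` in print) — satisfies `|S| ≦ (C_bLC₃)⁴M⁴R_k⁵`, by r13's `B16Sect1BoxCounts.cardΓ147_of_box`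
(`R_{h+1} ≦ C₃N^{β₀}R_k`, `4β₀ ≦ 1`, `1 ≦ N ≦ R_k` supplying the fifth power, `d = 4`).
[cite: Balaban1989LargeFieldII, (1.47) p.368; Balaban1989LargeFieldI, condition (i) p.177, p.195] -/
theorem card_le_of_embedding_box {β : Type*} {P : Params} {j' : ℕ} (hd4 : P.d = 4) (S : Finset β)
    (e : β → Site P j') (he : Set.InjOn e ↑S) (a : Site P j') (n : ℕ)
    (hbox : ∀ y ∈ S, e y ∈ B16Sect1BoxCounts.boxSites a n)
    {Cb Lr M Rh C₃ Rk β₀ : ℝ} {N : ℕ} (hn : (n : ℝ) ≤ Cb * Lr * M * Rh) (hRh : 0 ≤ Rh)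
    (hR : Rh ≤ C₃ * (N : ℝ) ^ β₀ * Rk) (hβ4 : 4 * β₀ ≤ 1) (hN1 : 1 ≤ N)
    (hNW : B16Sect1Kernels.NWindowUpper N Rk) :
    (#S : ℝ) ≤ (Cb * Lr * C₃) ^ 4 * M ^ 4 * Rk ^ 5 := by
  classical
  have hcard : #(S.image e) = #S := Finset.card_image_of_injOn he
  have hsub : S.image e ⊆ B16Sect1BoxCounts.boxSites a n := by
    intro x hx
    obtain ⟨y, hy, rfl⟩ := Finset.mem_image.mp hx
    exact hbox y hy
  have h := B16Sect1BoxCounts.cardΓ147_of_box hd4 (S.image e) a n hsub hn hRh hR hβ4 hN1 hNW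
  rw [hcard] at h
  exact h

/-- **(1.47) p. 368 BY NAME on the touching-cube contours with the box count ALSO DISCHARGED** — `ineq147_of_ineq190_touchC`
with its last counting hypothesis `|S| ≦ C_γM⁴R_k⁵` replaced by the embedding letter of `card_le_of_embedding_box` (the support
blocks `S` injected into a box of `n ≦ C_b·L·M·R_{h+1}` scale-`h` torus sites, `R_{h+1} ≦ C₃N^{β₀}R_k`, `4β₀ ≦ 1`, `d = 4`):
`Ineq147 … (C₀(1+C′)(1+β₀)²(2m·K261 …(δ/2))·(C_bLC₃)⁴) …`.  Every geometric AND counting input of (1.47) is now a theorem of the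
model; carried: (190), `hmv`, the source size/support with its zone data, the multiplicity, the J-side letters, `hne`, r13's
arithmetic dictionary, the printed shape of `Z″` and the numerics.
[cite: Balaban1989LargeFieldII, (1.47) p.368; Balaban1985Variational, Prop. 9 (190) pp.308–309; Balaban1984PropagatorsII, Lemma 2.1 (2.61) p.234, (2.2)–(2.4) p.224; Balaban1989LargeFieldI, condition (i) p.177, (1.12)–(1.13) p.179, p.186, p.195] -/
theorem ineq147_of_ineq190_touchC_box {T : Type*} {bB : BlockNorm g FB} {bout : BlockNorm g FA} {dH : T → FB →ₗ[ℝ] FA}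
    {Cc δ₀ σ τ B₃ δ C₀ Linv B₅ M alpha gk C' εk β₀ C₁ q₁g A₀ p₀g Rk : ℝ} {N k h Ngap : ℕ} {ε : ℕ → ℝ}
    {Γ : ℕ → Finset α} {dist : α → ℝ}
    (ι : g.Site → CubeSite M₁ L Z) (hι : Function.Injective ι)
    (hzone : ∀ y, zoneC (ι y) = g.scale y)
    (hdistG : ∀ y y', g.dist y y' = ((touchC M₁ L Z).dist (ι y) (ι y') : ℝ))
    (hmono : Monotone Z) (hsep : LayerSepZd Z MZ L) (htile : Tiles M₁ L Z) (hM₁ : 0 < M₁) (hL : 1 ≤ L)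
    (hNgap : 0 < Ngap) (hNgapL : Ngap + 1 ≤ L * (MZ / M₁))
    (hθσ : Real.exp (-σ) * (L : ℝ) ^ ((2 * d : ℝ) / Ngap) < 1)
    (hθδ : Real.exp (-(δ / 2)) * (L : ℝ) ^ ((2 * d : ℝ) / Ngap) < 1)
    (h190 : ∀ t, Ineq190 bB bout (dH t) Cc δ₀) (hCc : 0 ≤ Cc)
    (hτ : 0 ≤ τ) (hστ : σ + τ ≤ δ₀ / 8) (hδτ : δ ≤ τ) (B : FB) {HB : FA}
    (hmv : ∀ (y : g.Site) (s : ℝ), (∀ t, bout.loc y (dH t B) ≤ s) → bout.loc y HB ≤ s)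
    (hm : ∀ y', bB.loc y' B < C₀ * Linv ^ N * B₃ ^ 2 * B₅ * M ^ 6 * alpha)
    {S : Finset g.Site} (hSupp : ∀ y', bB.loc y' B ≠ 0 → y' ∈ S) (hzoneS : ∀ y' ∈ S, h + 1 ≤ g.scale y')
    (hCB : Cc * bB.κ * K261 Ngap d L 1 σ ≤ B₃) (hB₃ : 0 < B₃)
    {yOf : ℕ → α → g.Site} {nf : α → ℝ} {nJ s : ℕ → α → ℝ} {m : ℕ}
    (hzoneΓ : ∀ j ∈ Icc 1 h, ∀ x ∈ Γ j, g.scale (yOf j x) ≤ j)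
    (hmult : ∀ j ∈ Icc 1 h, ∀ y : g.Site, #{x ∈ Γ j | yOf j x = y} ≤ m)
    (hdistS : ∀ j ∈ Icc 1 h, ∀ x ∈ Γ j, ∀ y' ∈ S, dist x ≤ g.dist (yOf j x) y')
    (hdistS' : ∀ j ∈ Icc 1 h, ∀ x ∈ Γ j, ∃ y' ∈ S, g.dist (yOf j x) y' ≤ dist x)
    (hdom : ∀ j ∈ Icc 1 h, ∀ x ∈ Γ j, nf x ≤ bout.loc (yOf j x) HB)
    (hJ : ∀ j ∈ Icc 1 h, ∀ x ∈ Γ j, nJ j x ≤ ((gk ^ 2)⁻¹ + C' * ((k : ℝ) - j)) * ε j)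
    (hJnn : ∀ j ∈ Icc 1 h, ∀ x ∈ Γ j, 0 ≤ nJ j x)
    (hJpos : ∀ j ∈ Icc 1 h, (Γ j).Nonempty → 0 < ((gk ^ 2)⁻¹ + C' * ((k : ℝ) - j)) * ε j)
    (hpair : ∀ j ∈ Icc 1 h, ∀ x ∈ Γ j, |s j x| ≤ nf x * nJ j x)
    (hne : ∃ j ∈ Icc 1 h, (Γ j).Nonempty) {Tval : ℝ} (hT : Tval = ∑ j ∈ Icc 1 h, ∑ x ∈ Γ j, s j x)
    (hC : 0 ≤ C₀) (hLinv : 0 ≤ Linv) (hB₅ : 0 ≤ B₅) (hα : 0 ≤ alpha)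
    (hgk : 0 < gk) (hgk1 : gk ≤ 1) (hC' : 0 ≤ C') (hεk : 0 ≤ εk) (hδ : 0 ≤ δ) (hβ₀ : 0 ≤ β₀)
    (hβ₁ : β₀ ≤ 1) (hN : 1 ≤ N) (hk : k = h + N) (hδM : 6 ≤ δ * M) (hMN : M ≤ Ngap)
    (hε : ∀ j ∈ Icc 1 h, ε j ≤ (1 + β₀) ^ 2 * ((k : ℝ) - j) ^ β₀ * εk)
    (hαeq : alpha = C₁ * gk * q₁g) (hεeq : εk = gk * A₀ * p₀g) (hNW : B16Sect1Kernels.NWindowUpper N Rk)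
    -- the embedding letter replacing `hΓ`
    {P : Params} {j' : ℕ} (hd4 : P.d = 4) (e : g.Site → Site P j') (he : Set.InjOn e ↑S) (a : Site P j') (n : ℕ)
    (hbox : ∀ y ∈ S, e y ∈ B16Sect1BoxCounts.boxSites a n) {Cb Lr Rh C₃ : ℝ} (hn : (n : ℝ) ≤ Cb * Lr * M * Rh)
    (hRh : 0 ≤ Rh) (hR : Rh ≤ C₃ * (N : ℝ) ^ β₀ * Rk) (hβ4 : 4 * β₀ ≤ 1) :
    B16Sect1Statements.Ineq147 Tval
      ((C₀ * (1 + C') * (1 + β₀) ^ 2 * (2 * (m * K261 Ngap d L 1 (δ / 2)))) * (Cb * Lr * C₃) ^ 4) A₀ C₁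
      B₃ B₅ M p₀g q₁g Rk Linv N :=
  ineq147_of_ineq190_touchC ι hι hzone hdistG hmono hsep htile hM₁ hL hNgap hNgapL hθσ hθδ h190 hCc hτ hστ hδτ B hmv
    hm hSupp hzoneS hCB hB₃ hzoneΓ hmult hdistS hdistS' hdom hJ hJnn hJpos hpair hne hT hC hLinv hB₅ hα hgk hgk1 hC'
    hεk hδ hβ₀ hβ₁ hN hk hδM hMN hε hαeq hεeq hNW
    (card_le_of_embedding_box hd4 S e he a n hbox hn hRh hR hβ4 hN hNW)

end Touching

end

end Literature.MathematicalPhysics.QuantumFieldTheory.Balaban1983to89.B16Ineq147Count261
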